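import Summits.BirchSwinnertonDyer.BirchSwinnertonDyer.Theorems.SignedLowerHalvesSmallImageLowerHalfBothSignsRttCharRoadDivisibleEnd
import Literature.NumberTheory.NumberFields.RayClassFieldAdicCharacterLocalUnits
import HarnessLib

/-!
# Route `SignedLowerHalves`, crux L `SmallImageLowerHalfBothSigns` (stmt-BirchSwinnertonDyer-23599), line `rtt_w3` v12 — row T-2 / J-loc′ of INJ_top:
# EVERY `𝒪_{K_v}`-LINEAR ENDOMORPHISM OF A MODULE `T ≅ K_v/𝒪_v` IS A SCALAR

Hand `bsd-inputs-honda-p1` g20 (LEAD `cruxlead-stmt-BirchSwinnertonDyer-23599` g7); helper `--supports stmt-BirchSwinnertonDyer-23599`; THEOREMS ONLY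
(no definition, no named fact, no instance, no `sorry`).  BSD / crux L / INJ_top / T-2 are NOT proved here.

Transfer of `…RttCharRoadDivisibleEnd.exists_eq_smul_of_linear` (`End_{𝒪_v}(K_v/𝒪_v) = 𝒪_v`) through an additive bijection `α : T → K_v ⧸ 𝒪_v·1` which is
`𝒪_v`-linear for a family of "scalars" `u : 𝒪[K_v] → End T` (`α (u b t) = e_v b • α t`, `e_v = integerEquivAdicCompletionIntegers v`): ★ `exists_eq_scalar_of_commute`
— every additive `φ : T → T` commuting with all `u b` is `u c` for some `c ∈ 𝒪[K_v]`.  In T-2 (`T = (W ⊗ K)[p^∞]`, `u` and `α` from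
`…RttCharRoadTorsionModule.exists_torsionModule`) this turns the `𝒪_v`-linear maps `t ↦ s_i (r • j t)` into formal-module scalars `u c`: the ONE-TERM
expansion `hexp` of `…RttCharRoadE1LocalSatTransport.comp_mem_closure_localSatGen_of_expansion`, whose scalars are Kummer-stable by row B5-pts.

References: [SerreLocalFields1979] Ch. II §1; [LubinTate1965] §2 Thm. 2 and Cor. (`F_f[π^∞] ≅ K/𝒪` as `𝒪`-modules).
-/

set_option autoImplicit false
-- D-0017: single-problem summit, the namespace repeats the problem name by design.
set_option linter.dupNamespace false
noncomputable section

open scoped Classical NumberField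
open NumberField IsDedekindDomain IsDedekindDomain.HeightOneSpectrum ValuativeRel Literature.NumberTheory.NumberFields

namespace Summit.BirchSwinnertonDyer.BirchSwinnertonDyer.Theorems.SmallImageRttCharRoad

section Scalars

variable {K : Type} [Field K] [NumberField K] (v : HeightOneSpectrum (𝓞 K)) {T : Type*} [AddCommGroup T]

/-- ★ **Every endomorphism of `T ≅ K_v/𝒪_v` commuting with the scalars is a scalar.** Let `u : 𝒪[K_v] → End T` and `α : T → K_v ⧸ 𝒪_v·1` an
additive bijection with `α (u b t) = e_v b • α t`.  Then every additive `φ : T → T` with `φ ∘ u b = u b ∘ φ` for all `b` equals `u c` for some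
`c ∈ 𝒪[K_v]`: `α ∘ φ ∘ α⁻¹` is `𝒪_v`-linear on `K_v ⧸ 𝒪_v·1`, hence multiplication by some `c₀` (`exists_eq_smul_of_linear`), and `c = e_v⁻¹ c₀`.
[cite: SerreLocalFields1979, Ch. II §1] [cite: LubinTate1965, §2 Thm. 2 and Cor.] -/
theorem exists_eq_scalar_of_commute (u : 𝒪[v.adicCompletion K] → (T →+ T))
    (α : T →+ (v.adicCompletion K ⧸ Submodule.span (v.adicCompletionIntegers K) {(1 : v.adicCompletion K)}))
    (hα : Function.Bijective α)
    (hαu : ∀ (b : 𝒪[v.adicCompletion K]) (t : T), α (u b t) = integerEquivAdicCompletionIntegers v b • α t)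
    (φ : T →+ T) (hφ : ∀ (b : 𝒪[v.adicCompletion K]) (t : T), φ (u b t) = u b (φ t)) :
    ∃ c : 𝒪[v.adicCompletion K], ∀ t : T, φ t = u c t := by
  set e := AddEquiv.ofBijective α hα with he
  have heα : ∀ t, e t = α t := fun t ↦ rfl
  -- `ψ = α ∘ φ ∘ α⁻¹`
  set ψ : (v.adicCompletion K ⧸ Submodule.span (v.adicCompletionIntegers K) {(1 : v.adicCompletion K)}) →+
      (v.adicCompletion K ⧸ Submodule.span (v.adicCompletionIntegers K) {(1 : v.adicCompletion K)}) :=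
    (e.toAddMonoidHom.comp φ).comp e.symm.toAddMonoidHom with hψ
  have hψα : ∀ t, ψ (α t) = α (φ t) := by
    intro t
    change e (φ (e.symm (α t))) = α (φ t)
    rw [← heα t, e.symm_apply_apply, heα]
  -- `ψ` is `𝒪_v`-linear
  have hψlin : ∀ (c : v.adicCompletionIntegers K)
      (q : v.adicCompletion K ⧸ Submodule.span (v.adicCompletionIntegers K) {(1 : v.adicCompletion K)}), ψ (c • q) = c • ψ q := by
    intro c q
    obtain ⟨t, rfl⟩ := hα.2 q
    set b := (integerEquivAdicCompletionIntegers v).symm c with hb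
    have hcb : c = integerEquivAdicCompletionIntegers v b := by rw [hb, RingEquiv.apply_symm_apply]
    rw [hcb, ← hαu b t, hψα, hψα, hφ, hαu]
  obtain ⟨c₀, hc₀⟩ := exists_eq_smul_of_linear v ψ hψlin
  refine ⟨(integerEquivAdicCompletionIntegers v).symm c₀, fun t ↦ hα.1 ?_⟩
  rw [hαu, RingEquiv.apply_symm_apply, ← hc₀, hψα]

end Scalars

end Summit.BirchSwinnertonDyer.BirchSwinnertonDyer.Theorems.SmallImageRttCharRoad

end
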